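import Summits.HodgeConjecture.HodgeConjecture.Theorems.HodgeLocusCensusSchema
import HarnessLib

/-!
# HodgeLocusCensusK3Rows — the base case n = 2 of the census schema, PROVED: a line, and the Aoki–Shioda elliptic quartic, on the Fermat quartic K3 surface have first-order rank 1 (cell pub-hlocus, LEAD gen 4, (T22))
HONEST FRAMING: certified instances and evidence bearing on the general Hodge conjecture; no claim.

For n = 2, d = 4 Movasati's matrix `ivhsMatrix 2 4 ζ δ` has ONE row (I₀ = {0}: the form Ω/F, h^{2,0} = 1) and nineteen columns (I₄: the reduced
quartic monomials, h^{1,1}_prim = 19), so `IvhsRankEq 2 4 r δ` says r = 0 or 1 according as the row of periods of δ vanishes or not; rank 1 is the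
statement that the Noether–Lefschetz locus of the class is a hypersurface in the 19-dimensional first-order germ. The referee's table records the
(2,4) Aoki–Shioda CI(2,2) cell with rank 1 (`HodgeLocusCensusAokiShiodaRows.singleRankTable`, two engines); on S_F that class is the elliptic quartic
E = L(1,1) + L(1,5) + L(7,1) + L(7,5) (the block identity `block_d4`; it is the class identity [Z] = Σ Π coned up in every (n,4) cell of the census,
`HodgeLocusCensusGrassmannianCells`). Kernel-PROVED here, with no conjecture tags: (1) the closed form of the schema period of a line L(a₁,a₃) on
S_F; (2) |I₀| = 1, |I₄| = 19; (3) a matrix over a field with a nonzero entry has rank ≥ 1 (1×1 unit submatrix); (4) THE ROWS AS THEOREMS: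
`IvhsRankEq 2 4 1 [L(a₁,a₃)]` for all sixteen lines and `IvhsRankEq 2 4 1 E` for the Aoki–Shioda elliptic quartic — for every characteristic-0 field
and every primitive 8th root ζ (the nonzero witnesses are the periods at the column x₀²x₂x₃: ζ^{3(1+2a₁)+2(1+2a₃)} for the line, and
ζ⁵ + ζ¹³ + ζ²³ + ζ³¹ = 2ζ⁵(1 + ζ²) ≠ 0 for E, using ζ⁸ = 1, ζ⁴ ≠ 1 and 2 ≠ 0). These are the first census rank rows with r > 0 closed by proof
rather than by two-engine computation; the method (upper bound = a structural count, lower bound = an explicit nonzero minor whose entries are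
cyclotomic units up to the relations ζ⁸ = 1, ζ⁴ = −1) is the one that would close the n ≥ 4 rows, where the minors are 11×11 and larger.
-/

namespace Summit.HodgeConjecture.HodgeConjecture.HodgeLocus.Census.K3

/-- the line L(a₁,a₃) = V(x₀ − ζ^{2a₁+1}x₁, x₂ − ζ^{2a₃+1}x₃) on the Fermat quartic K3 surface S_F ⊂ ℙ³ (n = 2, b = id). -/
def line24 (a1 a3 : ℕ) : LinearCycle 2 := ⟨![0, a1, 0, a3], 1⟩

/-- the cycle [L(a₁,a₃)] as a one-term rational combination. -/
def lineL (a1 a3 : ℕ) : List (ℚ × LinearCycle 2) := [(1, line24 a1 a3)]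

/-- the Aoki–Shioda elliptic quartic E = L(1,1) + L(1,5) + L(7,1) + L(7,5) of S_F (exponent data (a₁,a₃) ∈ {0,3} × {0,2}). -/
def ellipticE : List (ℚ × LinearCycle 2) := [(1, line24 0 0), (1, line24 0 2), (1, line24 3 0), (1, line24 3 2)]

/-- (1) CLOSED FORM of the schema period of a line of S_F: ζ^{(i₀+1)(1+2a₁)+(i₂+1)(1+2a₃)} if i₀+i₁ = i₂+i₃ = 2, else 0. -/
theorem period_line24 {K : Type*} [Field K] (ζ : K) (a1 a3 : ℕ) (i : Fin 4 → ℕ) :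
    period 2 4 ζ (line24 a1 a3) i =
      if i 0 + i 1 = 2 ∧ i 2 + i 3 = 2 then ζ ^ ((i 0 + 1) * (1 + 2 * a1) + (i 2 + 1) * (1 + 2 * a3)) else 0 := by
  unfold period line24
  simp only [Equiv.Perm.coe_one, id_eq, Equiv.Perm.sign_one, Units.val_one, Int.cast_one, one_mul]
  have hc : (∀ e : Fin (2 / 2 + 1), i ⟨2 * (e : ℕ), by omega⟩ + i ⟨2 * (e : ℕ) + 1, by omega⟩ = 4 - 2) ↔
      (i 0 + i 1 = 2 ∧ i 2 + i 3 = 2) := by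
    simp [Fin.forall_fin_succ]
  have hs : (∑ e : Fin (2 / 2 + 1), (i ⟨2 * (e : ℕ), by omega⟩ + 1) * (1 + 2 * (![0, a1, 0, a3] : Fin 4 → ℕ) ⟨2 * (e : ℕ) + 1, by omega⟩))
      = (i 0 + 1) * (1 + 2 * a1) + (i 2 + 1) * (1 + 2 * a3) := by
    simp [Fin.sum_univ_succ]
  simp only [hc, hs]

/-- (2) the row index set I₀ of the K3 case is the single zero vector (h^{2,0} = 1) … -/
theorem card_indexSet_2_4_rows : (indexSet 2 4 0).card = 1 := by decide

/-- … and the column index set I₄ has nineteen elements (h^{1,1}_prim = 19). -/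
theorem card_indexSet_2_4_cols : (indexSet 2 4 4).card = 19 := by decide

/-- every row index of the K3 matrix is the zero exponent vector. -/
theorem rowIndex_eq_zero (i : Fin 4 → ℕ) (hi : i ∈ indexSet 2 4 (2 / 2 * 4 - 2 - 2)) : i = fun _ => 0 := by
  have h := (Finset.mem_filter.mp hi).2
  funext e
  exact (Finset.sum_eq_zero_iff.mp h) e (Finset.mem_univ e)

/-- (3) a matrix over a field with a nonzero entry has rank at least 1 (its 1×1 submatrix there is a unit). -/
theorem one_le_rank_of_ne_zero {m n K : Type*} [Fintype m] [Fintype n] [Field K] (A : Matrix m n K) (i : m) (j : n)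
    (h : A i j ≠ 0) : 1 ≤ A.rank := by
  classical
  have hsub : (A.submatrix (fun _ : Fin 1 => i) (fun _ : Fin 1 => j)).rank = 1 := by
    rw [Matrix.rank_of_isUnit _ ((Matrix.isUnit_iff_isUnit_det _).mpr (by
      rw [Matrix.det_fin_one]; exact isUnit_iff_ne_zero.mpr h)), Fintype.card_fin]
  calc 1 = _ := hsub.symm
    _ ≤ A.rank := Matrix.rank_submatrix_le A _ _

/-- the K3 matrix has rank ≤ 1 (one row). -/
theorem rank_le_one {K : Type*} [Field K] (ζ : K) (δ : List (ℚ × LinearCycle 2)) : (ivhsMatrix 2 4 ζ δ).rank ≤ 1 := by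
  have h := (ivhsMatrix 2 4 ζ δ).rank_le_card_height
  simpa [Fintype.card_coe, card_indexSet_2_4_rows] using h

/-- the column index x₀²x₂x₃ = (2,0,1,1) ∈ I₄ used as the nonzero witness. -/
def colWitness : indexSet 2 4 4 := ⟨![2, 0, 1, 1], by decide⟩

/-- the row index 0 ∈ I₀. -/
def rowZero : indexSet 2 4 (2 / 2 * 4 - 2 - 2) := ⟨fun _ => 0, by decide⟩

/-- the witness entry of the matrix of a line: the period at x₀²x₂x₃ is the unit ζ^{3(1+2a₁)+2(1+2a₃)}. -/
theorem entry_lineL {K : Type*} [Field K] (ζ : K) (a1 a3 : ℕ) :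
    ivhsMatrix 2 4 ζ (lineL a1 a3) rowZero colWitness = ζ ^ (3 * (1 + 2 * a1) + 2 * (1 + 2 * a3)) := by
  unfold ivhsMatrix lineL rowZero colWitness periodComb
  simp [period_line24]

/-- the witness entry of the matrix of E: ζ⁵ + ζ¹³ + ζ²³ + ζ³¹. -/
theorem entry_ellipticE {K : Type*} [Field K] (ζ : K) :
    ivhsMatrix 2 4 ζ ellipticE rowZero colWitness = ζ ^ 5 + ζ ^ 13 + ζ ^ 23 + ζ ^ 31 := by
  unfold ivhsMatrix ellipticE rowZero colWitness periodComb
  simp [period_line24]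
  ring

/-- (4a) PROVED ROW: every line of the Fermat quartic K3 has first-order rank 1 — `IvhsRankEq 2 4 1 [L(a₁,a₃)]`. -/
theorem ivhsRankEq_line (a1 a3 : ℕ) : IvhsRankEq 2 4 1 (lineL a1 a3) := by
  intro K _ _ ζ hζ
  refine le_antisymm (rank_le_one ζ _) (one_le_rank_of_ne_zero _ rowZero colWitness ?_)
  rw [entry_lineL]
  exact pow_ne_zero _ (hζ.ne_zero (by norm_num))

/-- (4b) PROVED ROW: the Aoki–Shioda elliptic quartic E of the Fermat quartic K3 has first-order rank 1 — `IvhsRankEq 2 4 1 E`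
(the (2,4) entry of the referee's single-class table, here a theorem). -/
theorem ivhsRankEq_ellipticE : IvhsRankEq 2 4 1 ellipticE := by
  intro K _ _ ζ hζ
  refine le_antisymm (rank_le_one ζ _) (one_le_rank_of_ne_zero _ rowZero colWitness ?_)
  rw [entry_ellipticE]
  have h8 : ζ ^ 8 = 1 := hζ.pow_eq_one
  have h4 : ζ ^ 4 ≠ 1 := hζ.pow_ne_one_of_pos_of_lt (by norm_num) (by norm_num)
  have hz : ζ ≠ 0 := hζ.ne_zero (by norm_num)
  have key : ζ ^ 5 + ζ ^ 13 + ζ ^ 23 + ζ ^ 31 = 2 * ζ ^ 5 * (1 + ζ ^ 2) := by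
    linear_combination (ζ ^ 5 + ζ ^ 7 * (ζ ^ 8 + 1) + ζ ^ 7 * (ζ ^ 16 + ζ ^ 8 + 1)) * h8
  rw [key]
  refine mul_ne_zero (mul_ne_zero two_ne_zero (pow_ne_zero _ hz)) ?_
  intro h0
  apply h4
  have h2 : ζ ^ 2 = -1 := by linear_combination h0
  calc ζ ^ 4 = (ζ ^ 2) ^ 2 := by ring
    _ = 1 := by rw [h2]; norm_num

/-- bookkeeping: E has four lines, and the exponents of its witness entry reduce mod 8 to 5, 5, 7, 7. -/
theorem ellipticE_bookkeeping : ellipticE.length = 4 ∧ 13 % 8 = 5 ∧ 23 % 8 = 7 ∧ 31 % 8 = 7 ∧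
    3 * (1 + 2 * 0) + 2 * (1 + 2 * 0) = 5 ∧ 3 * (1 + 2 * 0) + 2 * (1 + 2 * 2) = 13 ∧
    3 * (1 + 2 * 3) + 2 * (1 + 2 * 0) = 23 ∧ 3 * (1 + 2 * 3) + 2 * (1 + 2 * 2) = 31 := by
  refine ⟨rfl, by decide⟩

end Summit.HodgeConjecture.HodgeConjecture.HodgeLocus.Census.K3
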